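import Summits.ResolutionOfSingularities.ResolutionOfSingularities.Theorems.JacobianBudgetDefs

/-!
# Crux `BoundedMilnor` (stmt-ResolutionOfSingularities-16346), line `jacobian-budget`, stub
# `stub_exceptionalBudget` (lead) — part NF: normal forms of exceptional points

An exceptional point of the blow-up of the closed point of `L⟦u₁,…,uₙ⟧` is presented as
`q = (chart, translation) : Fin n × (Fin n → L)` with homogeneous coordinates
`pt q = Function.update q.2 q.1 1`; it is in NORMAL FORM (`NF q`) when the translation vanishes at
and after the chart index (`Theorems/JacobianBudgetDefs.lean`). This file proves that every
non-zero vector has exactly one normal-form presentation up to scalars (`nfOf`, `pt_nfOf`,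
`nf_nfOf`, `eq_of_nf_of_pt_eq_smul`), the bookkeeping behind "sum over all exceptional points" in
the budget argument. Mathlib only. [folklore]
-/

noncomputable section

-- single-problem summit: the doubled namespace component `ResolutionOfSingularities` is forced
set_option linter.dupNamespace false

open scoped BigOperators Classical

open Summit.ResolutionOfSingularities.ResolutionOfSingularities.Theorems.JacobianBudget (pt NF)

namespace Summit.ResolutionOfSingularities.ResolutionOfSingularities.Theorems.BoundedMilnorBudget

namespace NFKit

variable {n : ℕ} {L : Type} [Field L]

/-- The support (as a finset of indices) of a vector. [folklore] -/
def suppIdx (v : Fin n → L) : Finset (Fin n) := Finset.univ.filter fun j => v j ≠ 0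

/-- A non-zero vector has non-empty support. [folklore] -/
theorem suppIdx_nonempty {v : Fin n → L} (hv : v ≠ 0) : (suppIdx v).Nonempty := by
  by_contra h
  rw [Finset.not_nonempty_iff_eq_empty] at h
  apply hv
  funext j
  by_contra hj
  have : j ∈ suppIdx v := by
    simp only [suppIdx, Finset.mem_filter, Finset.mem_univ, true_and]
    exact hj
  rw [h] at this
  simp at this

/-- The last index at which a non-zero vector is non-zero. [folklore] -/
def lastIdx (v : Fin n → L) (hv : v ≠ 0) : Fin n := (suppIdx v).max' (suppIdx_nonempty hv)

/-- The vector is non-zero at its last index. [folklore] -/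
theorem apply_lastIdx_ne_zero (v : Fin n → L) (hv : v ≠ 0) : v (lastIdx v hv) ≠ 0 := by
  have := Finset.max'_mem (suppIdx v) (suppIdx_nonempty hv)
  simpa [suppIdx, lastIdx] using this

/-- The vector vanishes after its last index. [folklore] -/
theorem apply_eq_zero_of_lastIdx_lt (v : Fin n → L) (hv : v ≠ 0) {j : Fin n}
    (hj : lastIdx v hv < j) : v j = 0 := by
  by_contra h
  have hmem : j ∈ suppIdx v := by simp [suppIdx, h]
  have := Finset.le_max' (suppIdx v) j hmem
  exact absurd hj (not_lt.2 this)

/-- The normal-form presentation of a non-zero vector: chart = last non-zero index, translation =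
the rescaled earlier coordinates (zero at and after the chart). [folklore] -/
def nfOf (v : Fin n → L) (hv : v ≠ 0) : Fin n × (Fin n → L) :=
  (lastIdx v hv, fun j => if j < lastIdx v hv then v j / v (lastIdx v hv) else 0)

/-- `nfOf v` is in normal form. [folklore] -/
theorem nf_nfOf (v : Fin n → L) (hv : v ≠ 0) : NF (nfOf v hv) := by
  intro l hl
  simp only [nfOf] at hl ⊢
  rw [if_neg (not_lt.2 hl)]

/-- The homogeneous coordinates of `nfOf v` are `v` rescaled by its last non-zero entry. [folklore] -/
theorem pt_nfOf (v : Fin n → L) (hv : v ≠ 0) : pt (nfOf v hv) = (v (lastIdx v hv))⁻¹ • v := by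
  funext j
  simp only [pt, nfOf, Pi.smul_apply, smul_eq_mul]
  rcases lt_trichotomy j (lastIdx v hv) with h | h | h
  · rw [Function.update_of_ne (ne_of_lt h), if_pos h, div_eq_inv_mul]
  · subst h
    rw [Function.update_self, inv_mul_cancel₀ (apply_lastIdx_ne_zero v hv)]
  · rw [Function.update_of_ne (ne_of_gt h), if_neg (not_lt.2 (le_of_lt h)),
      apply_eq_zero_of_lastIdx_lt v hv h, mul_zero]

/-- A normal-form point has homogeneous coordinate `1` at its chart. [folklore] -/
theorem pt_apply_fst (q : Fin n × (Fin n → L)) : pt q q.1 = 1 := by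
  simp [pt]

/-- A normal-form point has vanishing homogeneous coordinates after its chart. [folklore] -/
theorem pt_apply_of_fst_lt {q : Fin n × (Fin n → L)} (hq : NF q) {j : Fin n} (hj : q.1 < j) :
    pt q j = 0 := by
  simp only [pt, Function.update_of_ne (ne_of_gt hj)]
  exact hq j (le_of_lt hj)

/-- Homogeneous coordinates before the chart are the translation. [folklore] -/
theorem pt_apply_of_lt_fst (q : Fin n × (Fin n → L)) {j : Fin n} (hj : j < q.1) :
    pt q j = q.2 j := by
  simp only [pt, Function.update_of_ne (ne_of_lt hj)]

/-- `pt q ≠ 0`. [folklore] -/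
theorem pt_ne_zero (q : Fin n × (Fin n → L)) : pt q ≠ 0 := fun h => by
  have := congrFun h q.1
  rw [pt_apply_fst] at this
  exact one_ne_zero this

/-- The chart of a normal-form point is the last non-zero index of its homogeneous coordinates.
[folklore] -/
theorem lastIdx_pt {q : Fin n × (Fin n → L)} (hq : NF q) : lastIdx (pt q) (pt_ne_zero q) = q.1 := by
  apply le_antisymm
  · by_contra h
    push Not at h
    exact apply_lastIdx_ne_zero (pt q) (pt_ne_zero q) (pt_apply_of_fst_lt hq h)
  · have hmem : q.1 ∈ suppIdx (pt q) := by simp [suppIdx, pt_apply_fst]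
    exact Finset.le_max' _ _ hmem

/-- **Uniqueness of the normal form**: two normal-form points with proportional homogeneous
coordinates are equal. [folklore] -/
theorem eq_of_nf_of_pt_eq_smul {q q' : Fin n × (Fin n → L)} (hq : NF q) (hq' : NF q')
    {s : L} (hs : s ≠ 0) (h : pt q' = s • pt q) : q' = q := by
  -- the charts agree: both are the last non-zero index
  have h1 : q'.1 = q.1 := by
    have a := lastIdx_pt hq'
    have hne : s • pt q ≠ 0 := smul_ne_zero hs (pt_ne_zero q)
    have b : lastIdx (s • pt q) hne = q.1 := by
      have : suppIdx (s • pt q) = suppIdx (pt q) := by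
        ext j; simp [suppIdx, hs]
      have lq := lastIdx_pt hq
      simp only [lastIdx, this] at lq ⊢
      exact lq
    rw [← a]
    have : lastIdx (pt q') (pt_ne_zero q') = lastIdx (s • pt q) hne := by
      simp only [lastIdx]
      congr 1
      · rw [h]
    rw [this, b]
  -- the scalar is 1
  have hs1 : s = 1 := by
    have := congrFun h q'.1
    rw [pt_apply_fst, Pi.smul_apply, h1, pt_apply_fst, smul_eq_mul, mul_one] at this
    exact this.symm
  subst hs1
  rw [one_smul] at h
  -- the translations agree
  ext j
  · exact congrArg Fin.val h1 |>.trans rfl |> fun e => by exact_mod_cast congrArg (fun x : ℕ => x) e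
  · rcases lt_or_ge j q.1 with hj | hj
    · have := congrFun h j
      rwa [pt_apply_of_lt_fst q' (h1 ▸ hj), pt_apply_of_lt_fst q hj] at this
    · rw [hq j hj, hq' j (h1 ▸ hj)]

/-- The normal form of the homogeneous coordinates of a normal-form point is the point itself.
[folklore] -/
theorem nfOf_pt {q : Fin n × (Fin n → L)} (hq : NF q) : nfOf (pt q) (pt_ne_zero q) = q := by
  apply eq_of_nf_of_pt_eq_smul hq (nf_nfOf _ _) (inv_ne_zero (apply_lastIdx_ne_zero _ _))
  exact pt_nfOf _ _

/-- Normal forms of proportional vectors agree. [folklore] -/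
theorem nfOf_smul {v : Fin n → L} (hv : v ≠ 0) {s : L} (hs : s ≠ 0) (hsv : s • v ≠ 0) :
    nfOf (s • v) hsv = nfOf v hv := by
  apply eq_of_nf_of_pt_eq_smul (nf_nfOf v hv) (nf_nfOf _ hsv)
    (s := (s * v (lastIdx v hv)) * ((s • v) (lastIdx (s • v) hsv))⁻¹)
  · exact mul_ne_zero (mul_ne_zero hs (apply_lastIdx_ne_zero v hv))
      (inv_ne_zero (apply_lastIdx_ne_zero _ hsv))
  · rw [pt_nfOf, pt_nfOf, smul_smul, smul_smul]
    congr 1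
    have hvl : v (lastIdx v hv) ≠ 0 := apply_lastIdx_ne_zero v hv
    field_simp

end NFKit

end Summit.ResolutionOfSingularities.ResolutionOfSingularities.Theorems.BoundedMilnorBudget

end
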